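import Mathlib
import HarnessLib.Audit
import Summits.PneNP.PneNP.Theorems.PstarChordBridge
import Summits.PneNP.PneNP.Theorems.PstarGapTwoSplit

/-!
# Glue: terminal-form data (`≤ 2` G-constraints as a finset) ⟶ the two constraints of bridge data (ROUND-24, GAPTWO-PLAN S1/S4)

FRONTIER range-avoidance ladder, rung F-N3, ROUND 24 (cell `pnp-ideate`; restricted-model proof complexity — nothing here bears on `P` versus `NP`).

`PstarGapTwoTerminal.terminal_form` / `PstarGapTwoDichotomy.small_or_chordal_core` / `PstarGapTwoAssembly.CoreBoundAt` present the constraints of a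
terminal core as a finset `𝒲` of at most two G-constraints `(C, G, b)`, with unsolvability (T3) and output-minimality (M0) quantified over `w ∈ 𝒲`.
`PstarChordBridge.BridgeData` carries exactly two constraints.  This file is the bookkeeping between the two presentations:

* the trivial constraint `(∅, ∅, false)` is always satisfied (`PstarGapTwoSplit.gval_empty_empty`);
* `exists_pair` — a finset of at most two constraints is represented by two constraints `w₁, w₂` (padding with the trivial one);
* `sat_pair_iff` — satisfaction of `𝒲` is satisfaction of `w₁` and `w₂`;
* `not_solution_of_T3`, `solution_erase_of_M0` — (T3) and (M0) in `𝒲`-form give `¬ Solution J₀` and `Solution (J₀ − e)` for bridge data whose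
  constraints are `w₁, w₂` — the two inputs of `PstarChordBridge.infeasible_of_not_solution` / `chordMinimal_of_solution_erase`
  (and of `PstarChordBridgeBasis.regime_cases`).

The remaining inputs of the bridge (the chord set `N` with leaf-peelable complement, fundamental sets, joins, no cross pendant) are CHOICES /
case hypotheses on the core, not consequences of the terminal form; they are left to the caller.
-/

set_option linter.dupNamespace false -- `Summit.PneNP.PneNP.…`: summit = sub-problem name (D-0017 single-conjunct layout)

open Finset Literature.Computability.Complexity
open Summit.PneNP.PneNP.Theorems.PstarPDT (parity)
open Summit.PneNP.PneNP.Theorems.PstarGapOneAll (gval)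
open Summit.PneNP.PneNP.Theorems.PstarChordBridge
open Summit.PneNP.PneNP.Theorems.PstarGapTwoSplit (gval_empty_empty)

namespace Summit.PneNP.PneNP.Theorems.PstarChordBridgeTerminal

variable {n m : ℕ}

/-- `w₁, w₂` REPRESENT the finset `𝒲`: every member is one of them, and each of them is a member or trivial. -/
def Represents (𝒲 : Finset (Finset (Fin n) × Finset (Fin m) × Bool)) (w₁ w₂ : Finset (Fin n) × Finset (Fin m) × Bool) : Prop :=
  (∀ w ∈ 𝒲, w = w₁ ∨ w = w₂) ∧ (w₁ ∈ 𝒲 ∨ w₁ = (∅, ∅, false)) ∧ (w₂ ∈ 𝒲 ∨ w₂ = (∅, ∅, false))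

/-- **At most two constraints are represented by two.** -/
theorem exists_pair (𝒲 : Finset (Finset (Fin n) × Finset (Fin m) × Bool)) (h : 𝒲.card ≤ 2) :
    ∃ w₁ w₂, Represents 𝒲 w₁ w₂ := by
  classical
  have hc : 𝒲.card = 0 ∨ 𝒲.card = 1 ∨ 𝒲.card = 2 := by omega
  rcases hc with h0 | h1 | h2
  · rw [card_eq_zero] at h0
    exact ⟨(∅, ∅, false), (∅, ∅, false), fun w hw => by rw [h0] at hw; exact absurd hw (notMem_empty w), Or.inr rfl, Or.inr rfl⟩
  · obtain ⟨a, ha⟩ := card_eq_one.1 h1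
    refine ⟨a, (∅, ∅, false), fun w hw => ?_, Or.inl (by rw [ha]; exact mem_singleton_self a), Or.inr rfl⟩
    rw [ha, mem_singleton] at hw
    exact Or.inl hw
  · obtain ⟨a, b, -, hab⟩ := card_eq_two.1 h2
    refine ⟨a, b, fun w hw => ?_, Or.inl (by rw [hab]; exact mem_insert_self a _),
      Or.inl (by rw [hab]; exact mem_insert_of_mem (mem_singleton_self b))⟩
    rw [hab, mem_insert, mem_singleton] at hw
    exact hw

/-- **Satisfying `𝒲` is satisfying its two representatives.** -/
theorem sat_pair_iff (I : LocalMap 4 n m) {𝒲 : Finset (Finset (Fin n) × Finset (Fin m) × Bool)}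
    {w₁ w₂ : Finset (Fin n) × Finset (Fin m) × Bool} (hrep : Represents 𝒲 w₁ w₂) (z : Fin n → Bool) :
    (∀ w ∈ 𝒲, gval I w.1 w.2.1 z = w.2.2) ↔ (gval I w₁.1 w₁.2.1 z = w₁.2.2 ∧ gval I w₂.1 w₂.2.1 z = w₂.2.2) := by
  obtain ⟨hall, h₁, h₂⟩ := hrep
  constructor
  · intro h
    refine ⟨?_, ?_⟩
    · rcases h₁ with h₁ | rfl
      · exact h w₁ h₁
      · exact gval_empty_empty I z
    · rcases h₂ with h₂ | rfl
      · exact h w₂ h₂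
      · exact gval_empty_empty I z
  · rintro ⟨hw₁, hw₂⟩ w hw
    rcases hall w hw with rfl | rfl
    · exact hw₁
    · exact hw₂

/-- Bridge data HAS CONSTRAINTS `w₁, w₂`. -/
def HasConstraints (B : BridgeData n m) (w₁ w₂ : Finset (Fin n) × Finset (Fin m) × Bool) : Prop :=
  B.C₁ = w₁.1 ∧ B.G₁ = w₁.2.1 ∧ B.b₁ = w₁.2.2 ∧ B.C₂ = w₂.1 ∧ B.G₂ = w₂.2.1 ∧ B.b₂ = w₂.2.2

/-- `Solution` in `𝒲`-form. -/
theorem solution_iff (I : LocalMap 4 n m) {B : BridgeData n m} {𝒲 : Finset (Finset (Fin n) × Finset (Fin m) × Bool)}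
    {w₁ w₂ : Finset (Fin n) × Finset (Fin m) × Bool} (hrep : Represents 𝒲 w₁ w₂) (hB : HasConstraints B w₁ w₂) (K : Finset (Fin m))
    (z : Fin n → Bool) : Solution I B K z ↔ (∀ j ∈ K, I.eval z j = B.y j) ∧ ∀ w ∈ 𝒲, gval I w.1 w.2.1 z = w.2.2 := by
  obtain ⟨h1, h2, h3, h4, h5, h6⟩ := hB
  unfold Solution
  rw [sat_pair_iff I hrep, h1, h2, h3, h4, h5, h6]

/-- **(T3) ⟹ no solution on `J₀`.** -/
theorem not_solution_of_T3 (I : LocalMap 4 n m) {B : BridgeData n m} {𝒲 : Finset (Finset (Fin n) × Finset (Fin m) × Bool)}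
    {w₁ w₂ : Finset (Fin n) × Finset (Fin m) × Bool} (hrep : Represents 𝒲 w₁ w₂) (hB : HasConstraints B w₁ w₂)
    (hT3 : ¬ ∃ z : Fin n → Bool, (∀ j ∈ B.J₀, I.eval z j = B.y j) ∧ ∀ w ∈ 𝒲, gval I w.1 w.2.1 z = w.2.2) :
    ¬ ∃ z, Solution I B B.J₀ z := by
  rintro ⟨z, hz⟩
  exact hT3 ⟨z, (solution_iff I hrep hB B.J₀ z).1 hz⟩

/-- **(M0) ⟹ a solution on `J₀ − e` for every chord `e`.** -/
theorem solution_erase_of_M0 (I : LocalMap 4 n m) {B : BridgeData n m} {𝒲 : Finset (Finset (Fin n) × Finset (Fin m) × Bool)}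
    {w₁ w₂ : Finset (Fin n) × Finset (Fin m) × Bool} (hrep : Represents 𝒲 w₁ w₂) (hB : HasConstraints B w₁ w₂) (hN : B.N ⊆ B.J₀)
    (hM0 : ∀ f ∈ B.J₀, ∃ z : Fin n → Bool, (∀ j ∈ B.J₀.erase f, I.eval z j = B.y j) ∧ ∀ w ∈ 𝒲, gval I w.1 w.2.1 z = w.2.2) :
    ∀ e ∈ B.N, ∃ z, Solution I B (B.J₀.erase e) z := by
  intro e he
  obtain ⟨z, hz⟩ := hM0 e (hN he)
  exact ⟨z, (solution_iff I hrep hB (B.J₀.erase e) z).2 hz⟩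

/-- **Monomials of the representatives are monomials of `𝒲`** (so hypotheses stated for the pendants of `𝒲` — no cross pendant, unread privates —
transfer to `B.G₁, B.G₂`). -/
theorem mem_of_hasConstraints {B : BridgeData n m} {𝒲 : Finset (Finset (Fin n) × Finset (Fin m) × Bool)}
    {w₁ w₂ : Finset (Fin n) × Finset (Fin m) × Bool} (hrep : Represents 𝒲 w₁ w₂) (hB : HasConstraints B w₁ w₂) {g : Fin m}
    (hg : g ∈ B.G₁ ∨ g ∈ B.G₂) : ∃ w ∈ 𝒲, g ∈ w.2.1 := by
  obtain ⟨-, h₁, h₂⟩ := hrep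
  obtain ⟨-, h2, -, -, h5, -⟩ := hB
  rcases hg with hg | hg
  · rw [h2] at hg
    rcases h₁ with h₁ | h₁
    · exact ⟨w₁, h₁, hg⟩
    · rw [h₁] at hg; exact absurd hg (notMem_empty g)
  · rw [h5] at hg
    rcases h₂ with h₂ | h₂
    · exact ⟨w₂, h₂, hg⟩
    · rw [h₂] at hg; exact absurd hg (notMem_empty g)

/-- Likewise for the linear parts. -/
theorem mem_of_hasConstraints_C {B : BridgeData n m} {𝒲 : Finset (Finset (Fin n) × Finset (Fin m) × Bool)}
    {w₁ w₂ : Finset (Fin n) × Finset (Fin m) × Bool} (hrep : Represents 𝒲 w₁ w₂) (hB : HasConstraints B w₁ w₂) {v : Fin n}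
    (hv : v ∈ B.C₁ ∨ v ∈ B.C₂) : ∃ w ∈ 𝒲, v ∈ w.1 := by
  obtain ⟨-, h₁, h₂⟩ := hrep
  obtain ⟨h1, -, -, h4, -, -⟩ := hB
  rcases hv with hv | hv
  · rw [h1] at hv
    rcases h₁ with h₁ | h₁
    · exact ⟨w₁, h₁, hv⟩
    · rw [h₁] at hv; exact absurd hv (notMem_empty v)
  · rw [h4] at hv
    rcases h₂ with h₂ | h₂
    · exact ⟨w₂, h₂, hv⟩
    · rw [h₂] at hv; exact absurd hv (notMem_empty v)

end Summit.PneNP.PneNP.Theorems.PstarChordBridgeTerminal
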